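import Summits.QuantumFields.YangMills.Theses.ComplexCouplingChannel
import Summits.QuantumFields.YangMills.Theorems.ComplexCouplingChannelHarmonicMeasureEngineTorusLeg
import Literature.MathematicalPhysics.QuantumFieldTheory.WilsonFinTorusPartitionComplex

/-!
# `HarmonicMeasureEngine`, torus leg instantiated: the route's anchor and window hypotheses give an
# exponentially small finite-size free energy of the symmetric torus at every large real coupling

Helper file for item `stmt-QuantumFields-18844` (`HarmonicMeasureEngine`, route `ComplexCouplingChannel` of
`QuantumFields/YangMills`).  It plugs the route's TYPED hypotheses `ComplexStrongCouplingAnchor` (torus clause)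
and `FreeEnergyWindowChannel` into the abstract torus leg
(`abs_log_norm_add_le_exp_neg_of_window`, file `…HarmonicMeasureEngineTorusLeg.lean`): the items' inline
complex partition function is `wilsonFinTorusPartitionC r.ρ` (`Literature/…/WilsonFinTorusPartitionComplex.lean`,
definitional), which is entire with value `1` at `0` and equals the real partition function at real coupling.

Result (`torusFreeEnergy_expSmall_of_anchor_of_window`): for every compact simple `G` and lattice representation
`r` there is `β₁` such that for every `β ≥ β₁` there are `F : ℝ` (the real part at `β` of the window's analytic
free energy), `a > 0`, `C'` and `P₁` with
`|log Z_r(β; P,P,P,P) + P⁴ F| ≤ C' e^{−aP}` for all `P ≥ P₁` — the symmetric-torus finite-size free energy at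
the weak coupling `β` is exponentially small, "paid by harmonic measure" from the strong-coupling disc.  This is
the input of the thermal-trace step of the engine; the remaining steps (tube leg: complex-coupling transfer
operator, crease lemma; Casimir sign; spectral bookkeeping) are not in this file.
-/

open Complex Metric Set
open Literature.MathematicalPhysics.QuantumFieldTheory
open Summit.QuantumFields.YangMills.Theses.ComplexCouplingChannel

namespace Summit.QuantumFields.YangMills.Theorems.ComplexCouplingChannel

/-- **Torus leg of the engine at the route's hypotheses.**  `ComplexStrongCouplingAnchor` and
`FreeEnergyWindowChannel` imply: for every compact simple `G` and every `r : LatticeRep G` there is `β₁` such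
that for all `β ≥ β₁` there are `F a C' P₁`, `a > 0`, with
`|log (wilsonFinTorusPartition r.ρ β P P P P) + P⁴ F| ≤ C' exp (−a P)` for all `P ≥ P₁`.
Proof: `abs_log_norm_add_le_exp_neg_of_window` applied to `Z P z = wilsonFinTorusPartitionC r.ρ z P P P P`
(entire, `= 1` at `z = 0`, real and positive at real `z`), with the disc radius `ρ := ρ₀` of the anchor fed to
the window hypothesis. [folklore] -/
theorem torusFreeEnergy_expSmall_of_anchor_of_window (hA : ComplexStrongCouplingAnchor)
    (hF : FreeEnergyWindowChannel)
    (G : Type) [Group G] [TopologicalSpace G] [IsTopologicalGroup G] [CompactSpace G] [MeasurableSpace G]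
    [BorelSpace G] (hG : IsCompactSimpleLieGroup G) (r : LatticeRep G) :
    ∃ β₁ : ℝ, ∀ β : ℝ, β₁ ≤ β → ∃ F a C' : ℝ, ∃ P₁ : ℕ, 0 < a ∧ ∀ P : ℕ, P₁ ≤ P →
      |Real.log (wilsonFinTorusPartition r.ρ β P P P P) + (P : ℝ) ^ 4 * F| ≤ C' * Real.exp (-(a * P)) := by
  haveI : SecondCountableTopology G :=
    (r.continuous.isClosedEmbedding r.injective).isEmbedding.secondCountableTopology
  have hA' := hA G hG r
  have hF' := hF G hG r
  obtain ⟨ρ₀, hρ₀, c, hc, -, fA, hfA, CA, hAt⟩ := hA'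
  obtain ⟨β₁, hβ₁⟩ := hF'
  refine ⟨β₁, fun β hβ => ?_⟩
  obtain ⟨D, hDo, hDc, hβD, ⟨x, hx, hxD⟩, f, hf, M, P₀, hW⟩ := hβ₁ β hβ ρ₀ hρ₀
  -- the items' inline `Zc z P P` is `wilsonFinTorusPartitionC r.ρ z P P P P` (definitional)
  have hdiff : ∀ P : ℕ, Differentiable ℂ fun z => wilsonFinTorusPartitionC r.ρ z P P P P := fun P =>
    differentiable_wilsonFinTorusPartitionC r.ρ r.continuous P P P P
  have key := abs_log_norm_add_le_exp_neg_of_window (fun P z => wilsonFinTorusPartitionC r.ρ z P P P P)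
    hρ₀ hc (fun P => (hdiff P).differentiableOn) (fun P => wilsonFinTorusPartitionC_zero r.ρ P P P P) hfA
    (fun P hP z hz => hAt P hP z hz) hDo hDc.isPreconnected (fun P => (hdiff P).differentiableOn) hβD
    (x := (x : ℂ)) (by simpa using hx) hxD hf (fun P hP z hz => hW P hP z hz)
  obtain ⟨a, ha, C', P₁, hP⟩ := key
  refine ⟨(f β).re, a, C', P₁, ha, fun P hP' => ?_⟩
  have h := hP P hP'
  simp only [wilsonFinTorusPartitionC_ofReal r.ρ β P P P P, norm_real, Real.norm_eq_abs,
    abs_of_pos (wilsonFinTorusPartition_pos r.continuous β P P P P)] at h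
  exact h

end Summit.QuantumFields.YangMills.Theorems.ComplexCouplingChannel
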